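import Literature.MathematicalPhysics.QuantumLattice.FreeFermionColumnToolbox
import Literature.MathematicalPhysics.QuantumLattice.TorusCooperSum
import Literature.MathematicalPhysics.QuantumLattice.FermiCurveGridCount
import Literature.MathematicalPhysics.QuantumLattice.DiscreteSineTransform
import Summits.HubbardSuperconductivity.HubbardSuperconductivity.Theorems.SoloBlindDiamondTrigSums
import HarnessLib

/-!
# The diamond trial Fermi sea on the torus: an explicit upper bound on the Fermi sum

Solo-blind residency `solo-HubbardSuperconductivity-blind`, session 7, Theorem 15 (part 2 of 3).
For the square-lattice band `ε_L(k) = -2(cos k₁ + cos k₂)` on the torus `(ℤ/Lℤ)²` (`torusBand`):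

* `sum_compl_torusBand_eq_neg` — `Σ_{k ∉ A} ε_L(k) = -Σ_{k ∈ A} ε_L(k)` (`L ≥ 2`; the band sums to zero);
* `neg_four_mul_card_le_fermiSum`, `neg_four_mul_le_fermiSum` — `Σ_F ε ≥ -4|F|` and
  `Σ_F ε ≥ -4(L² - |F|)` for every momentum set `F`;
* `sum_fermiSet_le_dilute` — the DILUTED TRIAL-SET bound: for a Fermi set `F` of `m ≤ L²` lowest
  levels and any momentum set `A` with `|A| ≤ m`, `|A| < L²`,
  `Σ_F ε ≤ (Σ_A ε) · (L² - m)/(L² - |A|)` (bathtub with occupation `1` on `A` and the uniform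
  fraction `(m - |A|)/(L² - |A|)` elsewhere, using `Σ_k ε = 0`);
* `diamondSet`, `card_diamondSet`, `sum_diamondSet_torusBand` — the lattice diamond
  `|j₁| + |j₂| ≤ K` embedded in the torus (`2K + 1 ≤ L`): `2K² + 2K + 1` momenta with
  `Σ ε = -2 S_K(2π/L) ≤ -8 L² sin²(Kπ/L)/π²`;
* `fermiSum_le_of_diamond` — hence for a Fermi set of `m ≤ L²` levels and any `K` with
  `2K² + 2K + 1 ≤ m`, `2K + 1 ≤ L`:
  `Σ_F ε_L ≤ -(8L²/π²) sin²(Kπ/L) · (L² - m)/(L² - (2K² + 2K + 1))`;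
* `sin_sq_sub_sin_sq_le`, `isInSector_smul` — two elementary lemmas for part 3.

Elementary; no sorry. [folklore] (bathtub principle: Lieb–Loss, *Analysis*, Thm 1.14.)
-/

noncomputable section

namespace Summit.HubbardSuperconductivity.HubbardSuperconductivity.Theorems.WeakCouplingSpin

open Finset Real Matrix Literature.MathematicalPhysics.QuantumLattice
open Literature.Probability.LatticeModels

variable {L : ℕ} [NeZero L]

/-! ### The band sums to zero; crude Fermi-sum bounds -/

/-- `Σ_{j ∈ ℤ/Lℤ} cos(2π j/L) = 0` for `L ≥ 2`. [folklore] -/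
theorem sum_cos_val_eq_zero (hL : 2 ≤ L) :
    ∑ j : ZMod L, Real.cos (2 * π * ((j.val : ℕ) : ℝ) / L) = 0 := by
  obtain ⟨n, rfl⟩ : ∃ n, L = n + 1 := ⟨L - 1, by omega⟩
  have h := Literature.MathematicalPhysics.QuantumLattice.DiscreteSine.sum_range_cos_two_pi_mul_div_eq_zero
    (N := n + 1) (m := 1) one_pos (by omega)
  rw [← Fin.sum_univ_eq_sum_range (fun u => Real.cos (2 * π * ((1 : ℕ) : ℝ) * u / ((n + 1 : ℕ) : ℝ)))] at h
  rw [← h]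
  refine Finset.sum_congr rfl fun j _ => ?_
  have hj : ((ZMod.val j : ℕ) : ℝ) = ((Fin.val j : ℕ) : ℝ) := rfl
  rw [hj]
  congr 1
  push_cast
  ring

/-- **Complement identity**: `Σ_{k ∉ A} ε_L(k) = -Σ_{k ∈ A} ε_L(k)` (`L ≥ 2`), because the band
sums to zero over the zone (each cosine sums to zero over `ℤ/Lℤ`). [folklore] -/
theorem sum_compl_torusBand_eq_neg (hL : 2 ≤ L) (A : Finset (TorusSite 2 L)) :
    ∑ k ∈ Aᶜ, torusBand L k = -∑ k ∈ A, torusBand L k := by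
  classical
  have hzone : ∑ k : TorusSite 2 L, torusBand L k = 0 := by
    rw [← (piFinTwoEquiv fun _ : Fin 2 => ZMod L).symm.sum_comp, Fintype.sum_prod_type]
    have h : ∀ a b : ZMod L, torusBand L ((piFinTwoEquiv fun _ : Fin 2 => ZMod L).symm (a, b)) =
        -2 * Real.cos (2 * π * ((a.val : ℕ) : ℝ) / L) - 2 * Real.cos (2 * π * ((b.val : ℕ) : ℝ) / L) := by
      intro a b
      rw [piFinTwoEquiv_symm_apply, torusBand_two_eq]
      rfl
    have hc := sum_cos_val_eq_zero (L := L) hL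
    have inner : ∀ a : ZMod L,
        ∑ b : ZMod L, torusBand L ((piFinTwoEquiv fun _ : Fin 2 => ZMod L).symm (a, b)) =
          (L : ℝ) * (-2 * Real.cos (2 * π * ((a.val : ℕ) : ℝ) / L)) := by
      intro a
      rw [Finset.sum_congr rfl fun b _ => h a b, Finset.sum_sub_distrib, Finset.sum_const,
        Finset.card_univ, ZMod.card, nsmul_eq_mul, ← Finset.mul_sum, hc, mul_zero, sub_zero]
    rw [Finset.sum_congr rfl fun a _ => inner a, ← Finset.mul_sum, ← Finset.mul_sum, hc, mul_zero,
      mul_zero]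
  have htot := Finset.sum_compl_add_sum A (fun k => torusBand L k)
  rw [hzone] at htot
  linarith

omit [NeZero L] in
/-- `Σ_F ε ≥ -4|F|`. [folklore] -/
theorem neg_four_mul_card_le_fermiSum (F : Finset (TorusSite 2 L)) :
    -4 * (F.card : ℝ) ≤ ∑ k ∈ F, torusBand L k := by
  have h : ∑ k ∈ F, (-4 : ℝ) ≤ ∑ k ∈ F, torusBand L k :=
    Finset.sum_le_sum fun k _ => neg_four_le_torusBand L k
  rw [Finset.sum_const, nsmul_eq_mul] at h
  linarith

/-- `Σ_F ε ≥ -4(L² - |F|)` (the complement has `L² - |F|` levels `≤ 4`, and `Σ_k ε = 0`).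
[folklore] -/
theorem neg_four_mul_le_fermiSum (hL : 2 ≤ L) (F : Finset (TorusSite 2 L)) :
    -4 * ((L : ℝ) ^ 2 - F.card) ≤ ∑ k ∈ F, torusBand L k := by
  classical
  have htot := sum_compl_torusBand_eq_neg hL F
  have hc : ∑ k ∈ Fᶜ, torusBand L k ≤ ∑ k ∈ Fᶜ, (4 : ℝ) :=
    Finset.sum_le_sum fun k _ => torusBand_le_four L k
  rw [Finset.sum_const, nsmul_eq_mul, Finset.card_compl, card_torusSite_two,
    Nat.cast_sub (by rw [← card_torusSite_two L]; exact Finset.card_le_univ F)] at hc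
  push_cast at hc
  linarith

/-! ### The diluted trial-set bound -/

/-- **Diluted trial set.** For a Fermi set `F` (levels `≤ e_F` inside, `≥ e_F` outside) with
`|F| = m ≤ L²` and any momentum set `A` with `|A| ≤ m` and `|A| < L²`:
`Σ_F ε ≤ (Σ_A ε) · (L² - m)/(L² - |A|)`.  Bathtub (`sum_fermiSet_le`) with the occupation that is
`1` on `A` and `(m - |A|)/(L² - |A|)` on the complement; the complement carries `-Σ_A ε`.
Lieb–Loss Thm 1.14. [folklore] -/
theorem sum_fermiSet_le_dilute (hL : 2 ≤ L) (F : Finset (TorusSite 2 L)) (eF : ℝ)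
    (hF : ∀ k ∈ F, torusBand L k ≤ eF) (hF' : ∀ k ∉ F, eF ≤ torusBand L k)
    (hm : F.card ≤ L ^ 2) (A : Finset (TorusSite 2 L)) (hAm : A.card ≤ F.card) (hAL : A.card < L ^ 2) :
    ∑ k ∈ F, torusBand L k ≤
      (∑ k ∈ A, torusBand L k) * (((L : ℝ) ^ 2 - F.card) / ((L : ℝ) ^ 2 - A.card)) := by
  classical
  set ρ : ℝ := ((F.card : ℝ) - A.card) / ((L : ℝ) ^ 2 - A.card) with hρ
  have hden : (0 : ℝ) < (L : ℝ) ^ 2 - A.card := by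
    have : (A.card : ℝ) < (L : ℝ) ^ 2 := by exact_mod_cast hAL
    linarith
  have hAm' : (A.card : ℝ) ≤ F.card := by exact_mod_cast hAm
  have hρ0 : 0 ≤ ρ := div_nonneg (by linarith) hden.le
  have hρ1 : ρ ≤ 1 := by
    rw [hρ, div_le_one hden]
    have : (F.card : ℝ) ≤ (L : ℝ) ^ 2 := by exact_mod_cast hm
    linarith
  set x : TorusSite 2 L → ℝ := fun k => if k ∈ A then 1 else ρ with hx
  have hx0 : ∀ k, 0 ≤ x k := fun k => by simp only [hx]; split_ifs <;> [exact zero_le_one; exact hρ0]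
  have hx1 : ∀ k, x k ≤ 1 := fun k => by simp only [hx]; split_ifs <;> [exact le_rfl; exact hρ1]
  have hAc : ((Aᶜ.card : ℕ) : ℝ) = (L : ℝ) ^ 2 - A.card := by
    rw [Finset.card_compl, card_torusSite_two, Nat.cast_sub hAL.le]; push_cast; ring
  have hxs : ∑ k, x k = F.card := by
    rw [← Finset.sum_compl_add_sum A, Finset.sum_ite_of_false (fun k hk => (Finset.mem_compl.1 hk)),
      Finset.sum_ite_of_true (fun k hk => hk), Finset.sum_const, Finset.sum_const, nsmul_eq_mul,
      nsmul_eq_mul, mul_one, hAc, hρ, mul_div_cancel₀ _ hden.ne']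
    ring
  have hb := sum_fermiSet_le (torusBand L) x F eF hF hF' hx0 hx1 hxs
  -- evaluate `Σ ε x`
  have htot := sum_compl_torusBand_eq_neg hL A
  have hval : ∑ k, torusBand L k * x k = (∑ k ∈ A, torusBand L k) * (1 - ρ) := by
    rw [← Finset.sum_compl_add_sum A]
    have h1 : ∑ k ∈ Aᶜ, torusBand L k * x k = ρ * ∑ k ∈ Aᶜ, torusBand L k := by
      rw [Finset.mul_sum]
      refine Finset.sum_congr rfl fun k hk => ?_
      rw [hx]; simp only [if_neg (Finset.mem_compl.1 hk)]; ring
    have h2 : ∑ k ∈ A, torusBand L k * x k = ∑ k ∈ A, torusBand L k := by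
      refine Finset.sum_congr rfl fun k hk => ?_
      rw [hx]; simp only [if_pos hk, mul_one]
    rw [h1, h2, htot]
    ring
  rw [hval] at hb
  have h1ρ : 1 - ρ = ((L : ℝ) ^ 2 - F.card) / ((L : ℝ) ^ 2 - A.card) := by
    rw [hρ, eq_div_iff hden.ne', sub_mul, div_mul_cancel₀ _ hden.ne']; ring
  rwa [h1ρ] at hb

/-! ### The lattice diamond embedded in the torus -/

/-- The embedding of the `ℕ × ℕ`-coded diamond into the torus: `(s, t) ↦ (s - K, t - K) mod L`.
[folklore] -/
def diamondEmb (L K : ℕ) (p : ℕ × ℕ) : TorusSite 2 L :=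
  ![(((p.1 : ℤ) - K : ℤ) : ZMod L), (((p.2 : ℤ) - K : ℤ) : ZMod L)]

/-- The embedded lattice diamond `|j₁| + |j₂| ≤ K` as a momentum set. [folklore] -/
def diamondSet (L K : ℕ) : Finset (TorusSite 2 L) := (diamondN K).image (diamondEmb L K)

omit [NeZero L] in
/-- The embedding is injective on `[0, 2K]²` once `2K + 1 ≤ L`. [folklore] -/
theorem diamondEmb_injOn {K : ℕ} (hK : 2 * K + 1 ≤ L) :
    Set.InjOn (diamondEmb L K) (diamondN K : Set (ℕ × ℕ)) := by
  intro p hp q hq hpq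
  have hp' : p.1 < 2 * K + 1 ∧ p.2 < 2 * K + 1 := by
    have := (Finset.mem_filter.1 (Finset.mem_coe.1 hp)).1
    simpa [Finset.mem_product] using this
  have hq' : q.1 < 2 * K + 1 ∧ q.2 < 2 * K + 1 := by
    have := (Finset.mem_filter.1 (Finset.mem_coe.1 hq)).1
    simpa [Finset.mem_product] using this
  have h0 := congrFun hpq 0
  have h1 := congrFun hpq 1
  simp only [diamondEmb, Matrix.cons_val_zero, Matrix.cons_val_one] at h0 h1
  have key : ∀ a b : ℕ, a < 2 * K + 1 → b < 2 * K + 1 →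
      ((((a : ℤ) - K : ℤ) : ZMod L)) = (((b : ℤ) - K : ℤ) : ZMod L) → a = b := by
    intro a b ha hb hab
    have hab' : ((a : ℤ) : ZMod L) = ((b : ℤ) : ZMod L) := by
      have := congrArg (· + ((K : ℤ) : ZMod L)) hab
      simpa using this
    rw [Int.cast_natCast, Int.cast_natCast, ZMod.natCast_eq_natCast_iff'] at hab'
    rwa [Nat.mod_eq_of_lt (by omega), Nat.mod_eq_of_lt (by omega)] at hab'
  exact Prod.ext (key _ _ hp'.1 hq'.1 h0) (key _ _ hp'.2 hq'.2 h1)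

omit [NeZero L] in
/-- **`|diamondSet L K| = 2K² + 2K + 1`** (`2K + 1 ≤ L`). [folklore] -/
theorem card_diamondSet {K : ℕ} (hK : 2 * K + 1 ≤ L) :
    ((diamondSet L K).card : ℝ) = 2 * (K : ℝ) ^ 2 + 2 * K + 1 := by
  rw [diamondSet, Finset.card_image_of_injOn (diamondEmb_injOn hK), card_diamondN]

/-- The band on the embedded diamond point `(s, t)`: `-2(cos((s-K)2π/L) + cos((t-K)2π/L))`.
[folklore] -/
theorem torusBand_diamondEmb (K : ℕ) (p : ℕ × ℕ) :
    torusBand L (diamondEmb L K p) =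
      -2 * (Real.cos (((p.1 : ℝ) - K) * (2 * π / L)) + Real.cos (((p.2 : ℝ) - K) * (2 * π / L))) := by
  rw [diamondEmb, torusBand_vec2]
  have h := fun j : ℤ => cos_two_pi_mul_val_intCast_div_sub (L := L) j 0
  simp only [sub_zero] at h
  rw [h, h]
  push_cast
  ring_nf

/-- **Energy of the diamond**: `Σ_{diamondSet} ε = -2 S_K(2π/L)` (`2K + 1 ≤ L`). [folklore] -/
theorem sum_diamondSet_torusBand {K : ℕ} (hK : 2 * K + 1 ≤ L) :
    ∑ k ∈ diamondSet L K, torusBand L k = -2 * diamondSum K (2 * π / L) := by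
  rw [diamondSet, Finset.sum_image (diamondEmb_injOn hK), diamondSum, Finset.mul_sum]
  exact Finset.sum_congr rfl fun p _ => torusBand_diamondEmb K p

/-- **The diamond Fermi-sum bound.** For `L ≥ 2`, a Fermi set `F` of `m ≤ L²` lowest levels and
any `K` with `2K² + 2K + 1 ≤ m`, `2K + 1 ≤ L`:
`Σ_F ε_L ≤ -(8L²/π²) sin²(Kπ/L) · (L² - m)/(L² - (2K² + 2K + 1))`. [folklore] -/
theorem fermiSum_le_of_diamond (hL : 2 ≤ L) (F : Finset (TorusSite 2 L)) (eF : ℝ)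
    (hF : ∀ k ∈ F, torusBand L k ≤ eF) (hF' : ∀ k ∉ F, eF ≤ torusBand L k)
    (hm : F.card ≤ L ^ 2) {K : ℕ} (hKm : 2 * K ^ 2 + 2 * K + 1 ≤ F.card) (hK : 2 * K + 1 ≤ L) :
    ∑ k ∈ F, torusBand L k ≤
      -(8 * (L : ℝ) ^ 2 / π ^ 2 * Real.sin ((K : ℝ) * π / L) ^ 2) *
        (((L : ℝ) ^ 2 - F.card) / ((L : ℝ) ^ 2 - (2 * (K : ℝ) ^ 2 + 2 * K + 1))) := by
  have hcard := card_diamondSet (L := L) hK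
  have hAm : (diamondSet L K).card ≤ F.card := by
    have : ((diamondSet L K).card : ℝ) ≤ F.card := by rw [hcard]; exact_mod_cast hKm
    exact_mod_cast this
  have hAL : (diamondSet L K).card < L ^ 2 := by
    have h1 : (2 * (K : ℝ) ^ 2 + 2 * K + 1) < (L : ℝ) ^ 2 := by
      have : (2 * (K : ℝ) + 1) ≤ L := by exact_mod_cast hK
      have hL' : (2 : ℝ) ≤ L := by exact_mod_cast hL
      nlinarith
    have : ((diamondSet L K).card : ℝ) < (L : ℝ) ^ 2 := by rw [hcard]; exact h1
    exact_mod_cast this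
  have h := sum_fermiSet_le_dilute hL F eF hF hF' hm (diamondSet L K) hAm hAL
  rw [sum_diamondSet_torusBand hK, hcard] at h
  refine h.trans ?_
  have hden : (0 : ℝ) < (L : ℝ) ^ 2 - (2 * (K : ℝ) ^ 2 + 2 * K + 1) := by
    have : ((diamondSet L K).card : ℝ) < (L : ℝ) ^ 2 := by exact_mod_cast hAL
    rw [hcard] at this; linarith
  have hfac : 0 ≤ ((L : ℝ) ^ 2 - F.card) / ((L : ℝ) ^ 2 - (2 * (K : ℝ) ^ 2 + 2 * K + 1)) :=
    div_nonneg (sub_nonneg.2 (by exact_mod_cast hm)) hden.le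
  refine mul_le_mul_of_nonneg_right ?_ hfac
  have hS := diamondSum_ge hL hK
  have : 8 * (L : ℝ) ^ 2 / π ^ 2 * Real.sin ((K : ℝ) * π / L) ^ 2 =
      2 * (4 * (L : ℝ) ^ 2 * Real.sin ((K : ℝ) * π / L) ^ 2 / π ^ 2) := by ring
  rw [this]
  linarith

/-! ### Two elementary lemmas for part 3 -/

/-- `|sin² a - sin² b| ≤ 2|a - b|`. [folklore] -/
theorem sin_sq_sub_sin_sq_le (a b : ℝ) : Real.sin b ^ 2 - 2 * |a - b| ≤ Real.sin a ^ 2 := by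
  have h1 := Real.abs_sin_sub_sin_le a b
  have ha1 := Real.abs_sin_le_one a
  have hb1 := Real.abs_sin_le_one b
  have h2 : |Real.sin a + Real.sin b| ≤ 2 := (abs_add_le _ _).trans (by linarith)
  have h3 : |Real.sin a ^ 2 - Real.sin b ^ 2| ≤ 2 * |a - b| := by
    rw [sq_sub_sq, abs_mul]
    exact mul_le_mul h2 h1 (abs_nonneg _) (by norm_num)
  linarith [(abs_le.1 h3).1]

omit [NeZero L] in
/-- Scalar multiples stay in a sector. [folklore] -/
theorem isInSector_smul {a b : ℕ} {ψ : Fock (Orb (FermionTorus 2 L))} (hψ : IsInSector a b ψ)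
    (c : ℂ) : IsInSector a b (c • ψ) := fun s hs => by
  rw [Pi.smul_apply, hψ s hs, smul_zero]

end Summit.HubbardSuperconductivity.HubbardSuperconductivity.Theorems.WeakCouplingSpin
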